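import Literature.AlgebraicGeometry.Motives.AbelianVarietyWeilPairingPullback
import Literature.AlgebraicGeometry.Motives.AbelianVarietyWeilPairingAlternating
import Literature.AlgebraicGeometry.Motives.AbelianVarietyTangentKillers
import HarnessLib

/-!
# The level adjoint of a CORRESPONDENCE WORD `q^* ≫ Nm_p` is the reversed word `p^* ≫ Nm_q` (Mumford §20 (3); Lang VII §2 Thm. 5)

Layer `Literature/AlgebraicGeometry/Motives`, namespace `Literature.AlgebraicGeometry.Motives.AbelianVariety`.  THEOREMS ONLY (no definition,
no named fact, no instance, no `sorry`; Mathlib + ★ `AbelianVarietyWeilPairingPullback` / `…Alternating` / `…TangentKillers`).  Cell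
`hodgecm-mathlib` (D-0151), fan A, road (P) leaf (L2) «correspondence adjoint» under A-p18 (g11)՚s (L) lead: the finite-level twin of the tower
adjointness ★ `HeckeOperatorAdjointBilinear` / ★ `EtaleH1TowerHeckeAdjoint` («`[KgK]† = [Kg⁻¹K]`»).  Count-neutral capital; HC_CM is proved only
modulo the 7 printed citations until rung 0 closes.

TERMINOLOGY (spelled out, never defined; = A-p18՚s `AbelianVarietyLevelAdjointCalculus`): for `x : A ⟶ B`, `x† : B ⟶ A`, divisors `Θ_A`,
`Θ_B` and `d ∈ ℕ`, «`(x, x†)` is a LEVEL ADJOINT PAIR of weight `d` for `(Θ_A, Θ_B)`» means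
`ē_N^{Θ_B}((d·x) P, Q) = ē_N^{Θ_A}(P, x† Q)` for all `P ∈ A[N](K)`, `Q ∈ B[N](K)`.

THE SITUATION.  A Hecke correspondence `X₁ ←p− X′ −q→ X₂` between curves acts on Jacobians by the push–pull word
`w = q^* ≫ Nm_p : J₂ → J₁` (first pull back along `q`, then push forward along `p`).  Its LETTERS come with level adjoints for the canonical
principal polarisations: `(q^*, Nm_q)` is a pair for `(Θ₂, Θ′)` and `(p^*, Nm_p)` a pair for `(Θ₁, Θ′)` — the content of ★
`Jacobian.galoisCover_pullback_isWeilPairingAdjoint_norm` ((F-P2), [LangeRodriguez2022] (3.3) «`\widehat{f^*} = Nm_f`»), taken here as HYPOTHESES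
`hq`, `hp` on three abstract abelian varieties `J₁`, `J₂`, `J′`.  CONCLUSION: the word has the REVERSED word as level adjoint,
`ē^{Θ₁}((d_q·(q^* ≫ Nm_p)) P, R) = ē^{Θ₂}(P, ((d_p·p^*) ≫ Nm_q) R)` — «`(Nm_p ∘ q^*)† = Nm_q ∘ p^*`», the transpose of a correspondence is
its Rosati adjoint ([BirkenhakeLange2004] Prop. 11.5.3 for correspondences of curves; [MumfordAV1970] §20 property (3) `e_n(f x, ŷ) = e_n(x, f̂ ŷ)`
for each letter, Lang VII §2 Thm. 5 (i) skew-symmetry for the reversal of `(p^*, Nm_p)`).  The reversal needs DIVISIBLE point groups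
(`R ↦ R^N` onto on `J₁(K)` and `J′(K)` — e.g. `K` algebraically closed of characteristic prime to `N`), exactly as ★ `weilPairingLevel_swap`.

* §1 `weilPairingLevel_map_eq_of_levelAdjoint_swap` — REVERSAL of one letter at one level: from `ē^{Θ′}((d·t) P, Q) = ē^{Θ₁}(P, n Q)` to
  `ē^{Θ₁}(n Q, R) = ē^{Θ′}(Q, (d·t) R)` on divisible points.
* §2 **`weilPairingLevel_pushPull_levelAdjoint`** — the word statement at one level `N` (hypotheses at that level only);
  **`levelAdjoint_pushPull`** — the same packaged with `∀ N` hypotheses in the (L)-calculus shape (weight `d_q`, adjoint `(d_p·p^*) ≫ Nm_q`).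

## References
* [MumfordAV1970] D. Mumford, *Abelian Varieties* (1970), §20 p. 186, property (3) of `e_n`; §21 (Rosati involution).
* [Lang1983AbelianVarieties] S. Lang, *Abelian Varieties* (1983), Ch. VII §2 Thm. 5 (i).
* [BirkenhakeLange2004] C. Birkenhake, H. Lange, *Complex Abelian Varieties* (2004), §11.5 Prop. 11.5.3 (correspondences and the Rosati involution).
-/

set_option autoImplicit false

universe u

open CategoryTheory AlgebraicGeometry

noncomputable section

namespace Literature.AlgebraicGeometry.Motives

namespace AbelianVariety

variable {K : Type u} [Field K] {J₁ J₂ J' : AbelianVariety K}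

/-- `(x ≫ y) P = y (x P)` on rational points (bookkeeping; = A-p18՚s `map_hom_comp_apply`). [folklore] -/
private theorem map_comp_apply' {A B C : AbelianVariety K} (x : A ⟶ B) (y : B ⟶ C) (P : A.Points K) :
    AlgPoints.map (x ≫ y).hom.hom.hom P = AlgPoints.map y.hom.hom.hom (AlgPoints.map x.hom.hom.hom P) := by
  rw [AlgPoints.map_apply, AlgPoints.map_apply, AlgPoints.map_apply]
  exact comp_hom_hom_hom_comp P x y

/-- `((1 : ℕ) • x) P = x P` as torsion points (bookkeeping). [folklore] -/
private theorem torsionPoints_map_one_zsmul {A B : AbelianVariety K} {N : ℤ} (x : A ⟶ B) (P : A.torsionPoints K N) :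
    (⟨AlgPoints.map (((1 : ℕ) : ℤ) • x).hom.hom.hom P.1, map_mem_torsionPoints (((1 : ℕ) : ℤ) • x) P.2⟩ : B.torsionPoints K N) =
      ⟨AlgPoints.map x.hom.hom.hom P.1, map_mem_torsionPoints x P.2⟩ :=
  Subtype.ext (by rw [Nat.cast_one, one_smul])

/-! ## §1 Reversal of one letter at one level -/

/-- **REVERSAL of a level adjoint pair at one level** (★ `weilPairingLevel_swap`, Lang VII §2 Thm. 5 (i)): on divisible point groups, from
`ē_N^{Θ′}((d·t) P, Q) = ē_N^{Θ₁}(P, n Q)` (for all `P ∈ J₁[N]`, `Q ∈ J′[N]`) one gets `ē_N^{Θ₁}(n Q, R) = ē_N^{Θ′}(Q, (d·t) R)` for all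
`Q ∈ J′[N]`, `R ∈ J₁[N]` — the pair `(n, d·t)` of weight `1` for `(Θ′, Θ₁)`. [cite: Lang1983AbelianVarieties, Ch. VII §2 Thm. 5 (i)]
[cite: MumfordAV1970, §20 (p. 186, property (3) of e_n)] -/
theorem weilPairingLevel_map_eq_of_levelAdjoint_swap (Θ₁ : CartierDivisor J₁.X.left) (Θ' : CartierDivisor J'.X.left)
    {t : J₁ ⟶ J'} {n : J' ⟶ J₁} {d : ℕ} {N : ℕ}
    [IsDominant (Hom.toSchemeHom ((N : ℤ) • 𝟙 J₁))] [IsDominant (Hom.toSchemeHom ((N : ℤ) • 𝟙 J'))]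
    (h : ∀ (P : J₁.torsionPoints K N) (Q : J'.torsionPoints K N),
      J'.weilPairingLevel Θ' ⟨AlgPoints.map ((d : ℤ) • t).hom.hom.hom P.1, map_mem_torsionPoints ((d : ℤ) • t) P.2⟩ Q =
        J₁.weilPairingLevel Θ₁ P ⟨AlgPoints.map n.hom.hom.hom Q.1, map_mem_torsionPoints n Q.2⟩)
    (h₁ : Function.Surjective fun R : J₁.Points K => R ^ N) (h' : Function.Surjective fun R : J'.Points K => R ^ N)
    (Q : J'.torsionPoints K N) (R : J₁.torsionPoints K N) :
    J₁.weilPairingLevel Θ₁ ⟨AlgPoints.map n.hom.hom.hom Q.1, map_mem_torsionPoints n Q.2⟩ R =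
      J'.weilPairingLevel Θ' Q ⟨AlgPoints.map ((d : ℤ) • t).hom.hom.hom R.1, map_mem_torsionPoints ((d : ℤ) • t) R.2⟩ := by
  have hd₁ : ∀ S : J₁.torsionPoints K N, ∃ S' : J₁.Points K, S' ^ N = S.1 := fun S => h₁ S.1
  have hd' : ∀ S : J'.torsionPoints K N, ∃ S' : J'.Points K, S' ^ N = S.1 := fun S => h' S.1
  rw [J₁.weilPairingLevel_swap Θ₁ R _ (hd₁ R) (hd₁ _), J'.weilPairingLevel_swap Θ' _ Q (hd' _) (hd' Q), h R Q]

/-! ## §2 The push–pull word and its reversed word -/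

/-- **`(Nm_p ∘ q^*)† = Nm_q ∘ (d_p·p^*)` AT ONE LEVEL.**  If at level `N` `(q^*, Nm_q)` is a level adjoint pair of weight `d_q` for `(Θ₂, Θ′)`
and `(p^*, Nm_p)` one of weight `d_p` for `(Θ₁, Θ′)` (the two (F-P2) letters of the correspondence `X₁ ←p− X′ −q→ X₂`), and `J₁(K)`, `J′(K)` are
`N`-divisible, then for `P ∈ J₂[N]`, `R ∈ J₁[N]`:
`ē_N^{Θ₁}((d_q·(q^* ≫ Nm_p)) P, R) = ē_N^{Θ₂}(P, ((d_p·p^*) ≫ Nm_q) R)` — pull back along `q`, push along `p`; the adjoint pulls back along `p`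
and pushes along `q`. [cite: MumfordAV1970, §20 (p. 186, property (3) of e_n) and §21] [cite: BirkenhakeLange2004, §11.5 Prop. 11.5.3]
[cite: Lang1983AbelianVarieties, Ch. VII §2 Thm. 5 (i)] -/
theorem weilPairingLevel_pushPull_levelAdjoint (Θ₁ : CartierDivisor J₁.X.left) (Θ₂ : CartierDivisor J₂.X.left)
    (Θ' : CartierDivisor J'.X.left) {tp : J₁ ⟶ J'} {np : J' ⟶ J₁} {dp : ℕ} {tq : J₂ ⟶ J'} {nq : J' ⟶ J₂} {dq : ℕ} {N : ℕ}
    [IsDominant (Hom.toSchemeHom ((N : ℤ) • 𝟙 J₁))] [IsDominant (Hom.toSchemeHom ((N : ℤ) • 𝟙 J₂))]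
    [IsDominant (Hom.toSchemeHom ((N : ℤ) • 𝟙 J'))]
    (hp : ∀ (P : J₁.torsionPoints K N) (Q : J'.torsionPoints K N),
      J'.weilPairingLevel Θ' ⟨AlgPoints.map ((dp : ℤ) • tp).hom.hom.hom P.1, map_mem_torsionPoints ((dp : ℤ) • tp) P.2⟩ Q =
        J₁.weilPairingLevel Θ₁ P ⟨AlgPoints.map np.hom.hom.hom Q.1, map_mem_torsionPoints np Q.2⟩)
    (hq : ∀ (P : J₂.torsionPoints K N) (Q : J'.torsionPoints K N),
      J'.weilPairingLevel Θ' ⟨AlgPoints.map ((dq : ℤ) • tq).hom.hom.hom P.1, map_mem_torsionPoints ((dq : ℤ) • tq) P.2⟩ Q =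
        J₂.weilPairingLevel Θ₂ P ⟨AlgPoints.map nq.hom.hom.hom Q.1, map_mem_torsionPoints nq Q.2⟩)
    (h₁ : Function.Surjective fun R : J₁.Points K => R ^ N) (h' : Function.Surjective fun R : J'.Points K => R ^ N)
    (P : J₂.torsionPoints K N) (R : J₁.torsionPoints K N) :
    J₁.weilPairingLevel Θ₁ ⟨AlgPoints.map ((dq : ℤ) • (tq ≫ np)).hom.hom.hom P.1, map_mem_torsionPoints ((dq : ℤ) • (tq ≫ np)) P.2⟩ R =
      J₂.weilPairingLevel Θ₂ P ⟨AlgPoints.map (((dp : ℤ) • tp) ≫ nq).hom.hom.hom R.1, map_mem_torsionPoints (((dp : ℤ) • tp) ≫ nq) R.2⟩ := by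
  -- `(d_q·(q^* ≫ Nm_p)) P = Nm_p ((d_q·q^*) P)`
  have e1 : (⟨AlgPoints.map ((dq : ℤ) • (tq ≫ np)).hom.hom.hom P.1, map_mem_torsionPoints ((dq : ℤ) • (tq ≫ np)) P.2⟩ :
        J₁.torsionPoints K N) =
      ⟨AlgPoints.map np.hom.hom.hom (AlgPoints.map ((dq : ℤ) • tq).hom.hom.hom P.1),
        map_mem_torsionPoints np (map_mem_torsionPoints ((dq : ℤ) • tq) P.2)⟩ :=
    Subtype.ext (by rw [← Preadditive.zsmul_comp]; exact map_comp_apply' _ _ P.1)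
  -- `((d_p·p^*) ≫ Nm_q) R = Nm_q ((d_p·p^*) R)`
  have e2 : (⟨AlgPoints.map (((dp : ℤ) • tp) ≫ nq).hom.hom.hom R.1, map_mem_torsionPoints (((dp : ℤ) • tp) ≫ nq) R.2⟩ :
        J₂.torsionPoints K N) =
      ⟨AlgPoints.map nq.hom.hom.hom (AlgPoints.map ((dp : ℤ) • tp).hom.hom.hom R.1),
        map_mem_torsionPoints nq (map_mem_torsionPoints ((dp : ℤ) • tp) R.2)⟩ :=
    Subtype.ext (map_comp_apply' _ _ R.1)
  rw [e1, e2, weilPairingLevel_map_eq_of_levelAdjoint_swap Θ₁ Θ' hp h₁ h' ⟨_, map_mem_torsionPoints ((dq : ℤ) • tq) P.2⟩ R,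
    hq P ⟨_, map_mem_torsionPoints ((dp : ℤ) • tp) R.2⟩]

/-- **`(Nm_p ∘ q^*)† = Nm_q ∘ (d_p·p^*)` IN THE (L)-CALCULUS SHAPE** (hypotheses and conclusion quantified over all levels with the dominance
binders; divisibility of `J₁(K)`, `J′(K)` at every such level — automatic over an algebraically closed field of characteristic `0`): the word
`q^* ≫ Nm_p : J₂ → J₁` and the reversed word `(d_p·p^*) ≫ Nm_q : J₁ → J₂` form a level adjoint pair of weight `d_q` for `(Θ₂, Θ₁)` — ready for
`levelAdjoint_sum` / `levelAdjoint_fan_entry` of the (L)-calculus to assemble `w_g† = w_{g⁻¹}` on `Y = ⊞_c J(E_c)`.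
[cite: MumfordAV1970, §20 (p. 186, property (3) of e_n) and §21] [cite: BirkenhakeLange2004, §11.5 Prop. 11.5.3]
[cite: Lang1983AbelianVarieties, Ch. VII §2 Thm. 5 (i)] -/
theorem levelAdjoint_pushPull (Θ₁ : CartierDivisor J₁.X.left) (Θ₂ : CartierDivisor J₂.X.left) (Θ' : CartierDivisor J'.X.left)
    {tp : J₁ ⟶ J'} {np : J' ⟶ J₁} {dp : ℕ} {tq : J₂ ⟶ J'} {nq : J' ⟶ J₂} {dq : ℕ}
    (hp : ∀ (N : ℕ) [IsDominant (Hom.toSchemeHom ((N : ℤ) • 𝟙 J₁))] [IsDominant (Hom.toSchemeHom ((N : ℤ) • 𝟙 J'))]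
      (P : J₁.torsionPoints K N) (Q : J'.torsionPoints K N),
      J'.weilPairingLevel Θ' ⟨AlgPoints.map ((dp : ℤ) • tp).hom.hom.hom P.1, map_mem_torsionPoints ((dp : ℤ) • tp) P.2⟩ Q =
        J₁.weilPairingLevel Θ₁ P ⟨AlgPoints.map np.hom.hom.hom Q.1, map_mem_torsionPoints np Q.2⟩)
    (hq : ∀ (N : ℕ) [IsDominant (Hom.toSchemeHom ((N : ℤ) • 𝟙 J₂))] [IsDominant (Hom.toSchemeHom ((N : ℤ) • 𝟙 J'))]
      (P : J₂.torsionPoints K N) (Q : J'.torsionPoints K N),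
      J'.weilPairingLevel Θ' ⟨AlgPoints.map ((dq : ℤ) • tq).hom.hom.hom P.1, map_mem_torsionPoints ((dq : ℤ) • tq) P.2⟩ Q =
        J₂.weilPairingLevel Θ₂ P ⟨AlgPoints.map nq.hom.hom.hom Q.1, map_mem_torsionPoints nq Q.2⟩)
    (hdiv₁ : ∀ (N : ℕ) [IsDominant (Hom.toSchemeHom ((N : ℤ) • 𝟙 J₁))], Function.Surjective fun R : J₁.Points K => R ^ N)
    (hdiv' : ∀ (N : ℕ) [IsDominant (Hom.toSchemeHom ((N : ℤ) • 𝟙 J'))], Function.Surjective fun R : J'.Points K => R ^ N)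
    (N : ℕ) [IsDominant (Hom.toSchemeHom ((N : ℤ) • 𝟙 J₂))] [IsDominant (Hom.toSchemeHom ((N : ℤ) • 𝟙 J₁))]
    [IsDominant (Hom.toSchemeHom ((N : ℤ) • 𝟙 J'))] (P : J₂.torsionPoints K N) (R : J₁.torsionPoints K N) :
    J₁.weilPairingLevel Θ₁ ⟨AlgPoints.map ((dq : ℤ) • (tq ≫ np)).hom.hom.hom P.1, map_mem_torsionPoints ((dq : ℤ) • (tq ≫ np)) P.2⟩ R =
      J₂.weilPairingLevel Θ₂ P ⟨AlgPoints.map (((dp : ℤ) • tp) ≫ nq).hom.hom.hom R.1, map_mem_torsionPoints (((dp : ℤ) • tp) ≫ nq) R.2⟩ :=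
  weilPairingLevel_pushPull_levelAdjoint Θ₁ Θ₂ Θ' (hp N) (hq N) (hdiv₁ N) (hdiv' N) P R

/-! ## §3 (Edition 2) The letters of a DOMINATED (non-Galois) cover: `Nm_f` and `f^*` for `f : Y → X` with `p = f ∘ q` Galois

THE SITUATION OF CURE (b) (A-plan2 (g12) RULING (L-Galois)).  A cover of curves `f : Y → X` need not be Galois (e.g. `X_{γ⁻¹Nγ} → X_K`), so
(F-P2) does not hand us the adjoint of `Nm_f` directly.  DOMINATE it: choose `q : Z → Y` with `p := f ∘ q : Z → X` such that BOTH `p` and `q`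
carry (F-P2) letters `hp`, `hq` (e.g. `Z = X_{N″}` for a normal sub-level `N″ ⊴ K`, `N″ ⊆ γ⁻¹Nγ`).  On Jacobians the TOWER relations are
`f^* ≫ q^* = p^*` (`htf`), `Nm_q ≫ Nm_f = Nm_p` (`hnf`, ★ `Jacobian.pushforward_comp`) and `q^* ≫ Nm_q = deg q` (`hdeg`, ★
`comp_pushforward_eq_card_zsmul`), whence `q^* ≫ Nm_p = (deg q)·Nm_f` and `p^* ≫ Nm_q = (deg q)·f^*`: the word of §2 IS the `Nm_f`-letter and
its reversed word IS the `f^*`-letter, up to the integer `deg q`.  So `(Nm_f, (d_p·deg q)·f^*)` is a level adjoint pair of weight `d_q·deg q`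
for `(Θ_Y, Θ_X)` and `(f^*, (d_q·deg q)·Nm_f)` one of weight `d_p·deg q` for `(Θ_X, Θ_Y)` — «`(Nm_f)† = f^*`» for EVERY finite cover, the
weights being bookkeeping of the LA-calculus (★ `levelAdjoint_weight_mul` equalises them, ★ `levelAdjoint_comp` composes, ★ `levelAdjoint_fan_sum`
sums).  All three varieties are abstract; the statements are in the two-variety `h`-shape of ★ `AbelianVarietyLevelAdjointCalculus`, the
dominance of `[N]` on `J′ = J_Z` being supplied by the hypothesis `hZ` (cf. `hY` of ★ `levelAdjoint_fan_sum`). -/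

/-- **The `Nm_f`-letter of a DOMINATED cover** («`(Nm_f)† = f^*` with weights»): with (F-P2) letters `hp` for `p = f ∘ q : Z → X` (on
`(J₁, J′) = (J_X, J_Z)`, weight `d_p`) and `hq` for `q : Z → Y` (on `(J₂, J′) = (J_Y, J_Z)`, weight `d_q`), and the tower relations
`htf : f^* ≫ q^* = p^*`, `hnf : Nm_q ≫ Nm_f = Nm_p`, `hdeg : q^* ≫ Nm_q = deg q`, one has at every level `N` (divisible points on `J_X`, `J_Z`)
`ē_N^{Θ_X}(((d_q·deg q)·Nm_f) P, R) = ē_N^{Θ_Y}(P, ((d_p·deg q)·f^*) R)` for `P ∈ J_Y[N]`, `R ∈ J_X[N]` — ★ `levelAdjoint_pushPull` for the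
word `q^* ≫ Nm_p = (deg q)·Nm_f`, whose reversed word is `(d_p·p^*) ≫ Nm_q = (d_p·deg q)·f^*`.
[cite: MumfordAV1970, §20 (p. 186, property (3) of e_n)] [cite: Lang1983AbelianVarieties, Ch. VII §2 Thm. 5 (i)] [cite: BirkenhakeLange2004, §11.5 Prop. 11.5.3] -/
theorem levelAdjoint_pushforward_of_dominated (Θ₁ : CartierDivisor J₁.X.left) (Θ₂ : CartierDivisor J₂.X.left) (Θ' : CartierDivisor J'.X.left)
    {tp : J₁ ⟶ J'} {np : J' ⟶ J₁} {dp : ℕ} {tq : J₂ ⟶ J'} {nq : J' ⟶ J₂} {dq : ℕ}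
    (hp : ∀ (N : ℕ) [IsDominant (Hom.toSchemeHom ((N : ℤ) • 𝟙 J₁))] [IsDominant (Hom.toSchemeHom ((N : ℤ) • 𝟙 J'))]
      (P : J₁.torsionPoints K N) (Q : J'.torsionPoints K N),
      J'.weilPairingLevel Θ' ⟨AlgPoints.map ((dp : ℤ) • tp).hom.hom.hom P.1, map_mem_torsionPoints ((dp : ℤ) • tp) P.2⟩ Q =
        J₁.weilPairingLevel Θ₁ P ⟨AlgPoints.map np.hom.hom.hom Q.1, map_mem_torsionPoints np Q.2⟩)
    (hq : ∀ (N : ℕ) [IsDominant (Hom.toSchemeHom ((N : ℤ) • 𝟙 J₂))] [IsDominant (Hom.toSchemeHom ((N : ℤ) • 𝟙 J'))]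
      (P : J₂.torsionPoints K N) (Q : J'.torsionPoints K N),
      J'.weilPairingLevel Θ' ⟨AlgPoints.map ((dq : ℤ) • tq).hom.hom.hom P.1, map_mem_torsionPoints ((dq : ℤ) • tq) P.2⟩ Q =
        J₂.weilPairingLevel Θ₂ P ⟨AlgPoints.map nq.hom.hom.hom Q.1, map_mem_torsionPoints nq Q.2⟩)
    {tf : J₁ ⟶ J₂} {nf : J₂ ⟶ J₁} {degq : ℕ}
    (htf : tf ≫ tq = tp) (hnf : nq ≫ nf = np) (hdeg : tq ≫ nq = (degq : ℤ) • 𝟙 J₂)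
    (hdiv₁ : ∀ (N : ℕ) [IsDominant (Hom.toSchemeHom ((N : ℤ) • 𝟙 J₁))], Function.Surjective fun R : J₁.Points K => R ^ N)
    (hdiv' : ∀ (N : ℕ) [IsDominant (Hom.toSchemeHom ((N : ℤ) • 𝟙 J'))], Function.Surjective fun R : J'.Points K => R ^ N)
    (hZ : ∀ (N : ℕ) [IsDominant (Hom.toSchemeHom ((N : ℤ) • 𝟙 J₁))], IsDominant (Hom.toSchemeHom ((N : ℤ) • 𝟙 J')))
    (N : ℕ) [IsDominant (Hom.toSchemeHom ((N : ℤ) • 𝟙 J₂))] [IsDominant (Hom.toSchemeHom ((N : ℤ) • 𝟙 J₁))]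
    (P : J₂.torsionPoints K N) (R : J₁.torsionPoints K N) :
    J₁.weilPairingLevel Θ₁
        ⟨AlgPoints.map (((dq * degq : ℕ) : ℤ) • nf).hom.hom.hom P.1, map_mem_torsionPoints (((dq * degq : ℕ) : ℤ) • nf) P.2⟩ R =
      J₂.weilPairingLevel Θ₂ P
        ⟨AlgPoints.map (((dp * degq : ℕ) : ℤ) • tf).hom.hom.hom R.1, map_mem_torsionPoints (((dp * degq : ℕ) : ℤ) • tf) R.2⟩ := by
  have e1 : ((dq * degq : ℕ) : ℤ) • nf = (dq : ℤ) • (tq ≫ np) := by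
    rw [← hnf, ← Category.assoc, hdeg, Preadditive.zsmul_comp, Category.id_comp, smul_smul, Nat.cast_mul]
  have e2 : ((dp * degq : ℕ) : ℤ) • tf = ((dp : ℤ) • tp) ≫ nq := by
    rw [← htf, Preadditive.zsmul_comp, Category.assoc, hdeg, Preadditive.comp_zsmul, Category.comp_id, smul_smul, Nat.cast_mul]
  haveI := hZ N
  rw [e1, e2]
  exact levelAdjoint_pushPull Θ₁ Θ₂ Θ' hp hq hdiv₁ hdiv' N P R

/-- **The `f^*`-letter of a DOMINATED cover** («`(f^*)† = Nm_f` with weights»): in the situation of `levelAdjoint_pushforward_of_dominated`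
(divisible points on `J_Y`, `J_Z` this time), at every level `N`, `ē_N^{Θ_Y}(((d_p·deg q)·f^*) P, R) = ē_N^{Θ_X}(P, ((d_q·deg q)·Nm_f) R)`
for `P ∈ J_X[N]`, `R ∈ J_Y[N]` — ★ `levelAdjoint_pushPull` for the TRANSPOSED correspondence (the word `p^* ≫ Nm_q = (deg q)·f^*`, reversed word
`(d_q·q^*) ≫ Nm_p = (d_q·deg q)·Nm_f`).
[cite: MumfordAV1970, §20 (p. 186, property (3) of e_n)] [cite: Lang1983AbelianVarieties, Ch. VII §2 Thm. 5 (i)] [cite: BirkenhakeLange2004, §11.5 Prop. 11.5.3] -/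
theorem levelAdjoint_pullback_of_dominated (Θ₁ : CartierDivisor J₁.X.left) (Θ₂ : CartierDivisor J₂.X.left) (Θ' : CartierDivisor J'.X.left)
    {tp : J₁ ⟶ J'} {np : J' ⟶ J₁} {dp : ℕ} {tq : J₂ ⟶ J'} {nq : J' ⟶ J₂} {dq : ℕ}
    (hp : ∀ (N : ℕ) [IsDominant (Hom.toSchemeHom ((N : ℤ) • 𝟙 J₁))] [IsDominant (Hom.toSchemeHom ((N : ℤ) • 𝟙 J'))]
      (P : J₁.torsionPoints K N) (Q : J'.torsionPoints K N),
      J'.weilPairingLevel Θ' ⟨AlgPoints.map ((dp : ℤ) • tp).hom.hom.hom P.1, map_mem_torsionPoints ((dp : ℤ) • tp) P.2⟩ Q =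
        J₁.weilPairingLevel Θ₁ P ⟨AlgPoints.map np.hom.hom.hom Q.1, map_mem_torsionPoints np Q.2⟩)
    (hq : ∀ (N : ℕ) [IsDominant (Hom.toSchemeHom ((N : ℤ) • 𝟙 J₂))] [IsDominant (Hom.toSchemeHom ((N : ℤ) • 𝟙 J'))]
      (P : J₂.torsionPoints K N) (Q : J'.torsionPoints K N),
      J'.weilPairingLevel Θ' ⟨AlgPoints.map ((dq : ℤ) • tq).hom.hom.hom P.1, map_mem_torsionPoints ((dq : ℤ) • tq) P.2⟩ Q =
        J₂.weilPairingLevel Θ₂ P ⟨AlgPoints.map nq.hom.hom.hom Q.1, map_mem_torsionPoints nq Q.2⟩)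
    {tf : J₁ ⟶ J₂} {nf : J₂ ⟶ J₁} {degq : ℕ}
    (htf : tf ≫ tq = tp) (hnf : nq ≫ nf = np) (hdeg : tq ≫ nq = (degq : ℤ) • 𝟙 J₂)
    (hdiv₂ : ∀ (N : ℕ) [IsDominant (Hom.toSchemeHom ((N : ℤ) • 𝟙 J₂))], Function.Surjective fun R : J₂.Points K => R ^ N)
    (hdiv' : ∀ (N : ℕ) [IsDominant (Hom.toSchemeHom ((N : ℤ) • 𝟙 J'))], Function.Surjective fun R : J'.Points K => R ^ N)
    (hZ : ∀ (N : ℕ) [IsDominant (Hom.toSchemeHom ((N : ℤ) • 𝟙 J₁))], IsDominant (Hom.toSchemeHom ((N : ℤ) • 𝟙 J')))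
    (N : ℕ) [IsDominant (Hom.toSchemeHom ((N : ℤ) • 𝟙 J₁))] [IsDominant (Hom.toSchemeHom ((N : ℤ) • 𝟙 J₂))]
    (P : J₁.torsionPoints K N) (R : J₂.torsionPoints K N) :
    J₂.weilPairingLevel Θ₂
        ⟨AlgPoints.map (((dp * degq : ℕ) : ℤ) • tf).hom.hom.hom P.1, map_mem_torsionPoints (((dp * degq : ℕ) : ℤ) • tf) P.2⟩ R =
      J₁.weilPairingLevel Θ₁ P
        ⟨AlgPoints.map (((dq * degq : ℕ) : ℤ) • nf).hom.hom.hom R.1, map_mem_torsionPoints (((dq * degq : ℕ) : ℤ) • nf) R.2⟩ := by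
  have e3 : ((dp * degq : ℕ) : ℤ) • tf = (dp : ℤ) • (tp ≫ nq) := by
    rw [← htf, Category.assoc, hdeg, Preadditive.comp_zsmul, Category.comp_id, smul_smul, Nat.cast_mul]
  have e4 : ((dq * degq : ℕ) : ℤ) • nf = ((dq : ℤ) • tq) ≫ np := by
    rw [← hnf, Preadditive.zsmul_comp, ← Category.assoc, hdeg, Preadditive.zsmul_comp, Category.id_comp, smul_smul, Nat.cast_mul]
  haveI := hZ N
  rw [e3, e4]
  exact levelAdjoint_pushPull Θ₂ Θ₁ Θ' hq hp hdiv₂ hdiv' N P R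

/-! ## §4 (Edition 3) The same letters WITHOUT the non-Galois pull-back as data (A-p04 (g16)՚s instantiability point)

The tree pins `q^* =: tq`, `p^* =: tp` only for GALOIS covers (the pinned pull-back of ★ `JacobianGaloisCoverNorm`, (L3)
`Jacobian.exists_galoisCover_letters`); for the dominated NON-Galois `f` there is no morphism `f^*` to hand over.  So §3 is restated
`tf`-free: the `Nm_f`-letter՚s adjoint is the WORD `(d_p·p^*) ≫ Nm_q` through `Z` (which is `(d_p·deg q)·f^*` whenever `f^*` exists), and
the «`f^*`»-letter is that word itself, of weight `1`, with adjoint `(d_q·deg q)·Nm_f`.  Hypotheses: the two (F-P2) letters `hp`, `hq`, the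
push-forward tower `hnf : Nm_q ≫ Nm_f = Nm_p`, the degree `hdeg : q^* ≫ Nm_q = deg q`, divisibility, and `hZ`. -/

/-- **The `Nm_f`-letter of a dominated cover, `f^*`-free form**: `ē_N^{Θ_X}(((d_q·deg q)·Nm_f) P, R) = ē_N^{Θ_Y}(P, ((d_p·p^*) ≫ Nm_q) R)`
for `P ∈ J_Y[N]`, `R ∈ J_X[N]` — the pair `(Nm_f, (d_p·p^*) ≫ Nm_q)` of weight `d_q·deg q` for `(Θ_Y, Θ_X)`; ★ `levelAdjoint_pushPull` for the
word `q^* ≫ Nm_p = (deg q)·Nm_f`. [cite: MumfordAV1970, §20 (p. 186, property (3) of e_n)] [cite: Lang1983AbelianVarieties, Ch. VII §2 Thm. 5 (i)]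
[cite: BirkenhakeLange2004, §11.5 Prop. 11.5.3] -/
theorem levelAdjoint_pushforward_of_dominated' (Θ₁ : CartierDivisor J₁.X.left) (Θ₂ : CartierDivisor J₂.X.left)
    (Θ' : CartierDivisor J'.X.left)
    {tp : J₁ ⟶ J'} {np : J' ⟶ J₁} {dp : ℕ} {tq : J₂ ⟶ J'} {nq : J' ⟶ J₂} {dq : ℕ}
    (hp : ∀ (N : ℕ) [IsDominant (Hom.toSchemeHom ((N : ℤ) • 𝟙 J₁))] [IsDominant (Hom.toSchemeHom ((N : ℤ) • 𝟙 J'))]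
      (P : J₁.torsionPoints K N) (Q : J'.torsionPoints K N),
      J'.weilPairingLevel Θ' ⟨AlgPoints.map ((dp : ℤ) • tp).hom.hom.hom P.1, map_mem_torsionPoints ((dp : ℤ) • tp) P.2⟩ Q =
        J₁.weilPairingLevel Θ₁ P ⟨AlgPoints.map np.hom.hom.hom Q.1, map_mem_torsionPoints np Q.2⟩)
    (hq : ∀ (N : ℕ) [IsDominant (Hom.toSchemeHom ((N : ℤ) • 𝟙 J₂))] [IsDominant (Hom.toSchemeHom ((N : ℤ) • 𝟙 J'))]
      (P : J₂.torsionPoints K N) (Q : J'.torsionPoints K N),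
      J'.weilPairingLevel Θ' ⟨AlgPoints.map ((dq : ℤ) • tq).hom.hom.hom P.1, map_mem_torsionPoints ((dq : ℤ) • tq) P.2⟩ Q =
        J₂.weilPairingLevel Θ₂ P ⟨AlgPoints.map nq.hom.hom.hom Q.1, map_mem_torsionPoints nq Q.2⟩)
    {nf : J₂ ⟶ J₁} {degq : ℕ} (hnf : nq ≫ nf = np) (hdeg : tq ≫ nq = (degq : ℤ) • 𝟙 J₂)
    (hdiv₁ : ∀ (N : ℕ) [IsDominant (Hom.toSchemeHom ((N : ℤ) • 𝟙 J₁))], Function.Surjective fun R : J₁.Points K => R ^ N)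
    (hdiv' : ∀ (N : ℕ) [IsDominant (Hom.toSchemeHom ((N : ℤ) • 𝟙 J'))], Function.Surjective fun R : J'.Points K => R ^ N)
    (hZ : ∀ (N : ℕ) [IsDominant (Hom.toSchemeHom ((N : ℤ) • 𝟙 J₁))], IsDominant (Hom.toSchemeHom ((N : ℤ) • 𝟙 J')))
    (N : ℕ) [IsDominant (Hom.toSchemeHom ((N : ℤ) • 𝟙 J₂))] [IsDominant (Hom.toSchemeHom ((N : ℤ) • 𝟙 J₁))]
    (P : J₂.torsionPoints K N) (R : J₁.torsionPoints K N) :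
    J₁.weilPairingLevel Θ₁
        ⟨AlgPoints.map (((dq * degq : ℕ) : ℤ) • nf).hom.hom.hom P.1, map_mem_torsionPoints (((dq * degq : ℕ) : ℤ) • nf) P.2⟩ R =
      J₂.weilPairingLevel Θ₂ P
        ⟨AlgPoints.map (((dp : ℤ) • tp) ≫ nq).hom.hom.hom R.1, map_mem_torsionPoints (((dp : ℤ) • tp) ≫ nq) R.2⟩ := by
  have e1 : ((dq * degq : ℕ) : ℤ) • nf = (dq : ℤ) • (tq ≫ np) := by
    rw [← hnf, ← Category.assoc, hdeg, Preadditive.zsmul_comp, Category.id_comp, smul_smul, Nat.cast_mul]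
  haveI := hZ N
  rw [e1]
  exact levelAdjoint_pushPull Θ₁ Θ₂ Θ' hp hq hdiv₁ hdiv' N P R

/-- **The «`f^*`»-letter of a dominated cover, `f^*`-free form**: the word `x := (d_p·p^*) ≫ Nm_q : J_X → J_Y` through `Z` (it equals
`(d_p·deg q)·f^*` whenever a pull-back `f^*` with `f^* ≫ q^* = p^*` exists) is a level adjoint pair `(x, (d_q·deg q)·Nm_f)` of weight `1` for
`(Θ_X, Θ_Y)`: `ē_N^{Θ_Y}((1·x) P, R) = ē_N^{Θ_X}(P, ((d_q·deg q)·Nm_f) R)` for `P ∈ J_X[N]`, `R ∈ J_Y[N]` (divisible points on `J_Y`, `J_Z`) — ★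
`levelAdjoint_pushPull` for the transposed correspondence. [cite: MumfordAV1970, §20 (p. 186, property (3) of e_n)]
[cite: Lang1983AbelianVarieties, Ch. VII §2 Thm. 5 (i)] [cite: BirkenhakeLange2004, §11.5 Prop. 11.5.3] -/
theorem levelAdjoint_pullback_of_dominated' (Θ₁ : CartierDivisor J₁.X.left) (Θ₂ : CartierDivisor J₂.X.left)
    (Θ' : CartierDivisor J'.X.left)
    {tp : J₁ ⟶ J'} {np : J' ⟶ J₁} {dp : ℕ} {tq : J₂ ⟶ J'} {nq : J' ⟶ J₂} {dq : ℕ}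
    (hp : ∀ (N : ℕ) [IsDominant (Hom.toSchemeHom ((N : ℤ) • 𝟙 J₁))] [IsDominant (Hom.toSchemeHom ((N : ℤ) • 𝟙 J'))]
      (P : J₁.torsionPoints K N) (Q : J'.torsionPoints K N),
      J'.weilPairingLevel Θ' ⟨AlgPoints.map ((dp : ℤ) • tp).hom.hom.hom P.1, map_mem_torsionPoints ((dp : ℤ) • tp) P.2⟩ Q =
        J₁.weilPairingLevel Θ₁ P ⟨AlgPoints.map np.hom.hom.hom Q.1, map_mem_torsionPoints np Q.2⟩)
    (hq : ∀ (N : ℕ) [IsDominant (Hom.toSchemeHom ((N : ℤ) • 𝟙 J₂))] [IsDominant (Hom.toSchemeHom ((N : ℤ) • 𝟙 J'))]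
      (P : J₂.torsionPoints K N) (Q : J'.torsionPoints K N),
      J'.weilPairingLevel Θ' ⟨AlgPoints.map ((dq : ℤ) • tq).hom.hom.hom P.1, map_mem_torsionPoints ((dq : ℤ) • tq) P.2⟩ Q =
        J₂.weilPairingLevel Θ₂ P ⟨AlgPoints.map nq.hom.hom.hom Q.1, map_mem_torsionPoints nq Q.2⟩)
    {nf : J₂ ⟶ J₁} {degq : ℕ} (hnf : nq ≫ nf = np) (hdeg : tq ≫ nq = (degq : ℤ) • 𝟙 J₂)
    (hdiv₂ : ∀ (N : ℕ) [IsDominant (Hom.toSchemeHom ((N : ℤ) • 𝟙 J₂))], Function.Surjective fun R : J₂.Points K => R ^ N)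
    (hdiv' : ∀ (N : ℕ) [IsDominant (Hom.toSchemeHom ((N : ℤ) • 𝟙 J'))], Function.Surjective fun R : J'.Points K => R ^ N)
    (hZ : ∀ (N : ℕ) [IsDominant (Hom.toSchemeHom ((N : ℤ) • 𝟙 J₁))], IsDominant (Hom.toSchemeHom ((N : ℤ) • 𝟙 J')))
    (N : ℕ) [IsDominant (Hom.toSchemeHom ((N : ℤ) • 𝟙 J₁))] [IsDominant (Hom.toSchemeHom ((N : ℤ) • 𝟙 J₂))]
    (P : J₁.torsionPoints K N) (R : J₂.torsionPoints K N) :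
    J₂.weilPairingLevel Θ₂
        ⟨AlgPoints.map (((1 : ℕ) : ℤ) • (((dp : ℤ) • tp) ≫ nq)).hom.hom.hom P.1,
          map_mem_torsionPoints (((1 : ℕ) : ℤ) • (((dp : ℤ) • tp) ≫ nq)) P.2⟩ R =
      J₁.weilPairingLevel Θ₁ P
        ⟨AlgPoints.map (((dq * degq : ℕ) : ℤ) • nf).hom.hom.hom R.1, map_mem_torsionPoints (((dq * degq : ℕ) : ℤ) • nf) R.2⟩ := by
  have e3 : ((1 : ℕ) : ℤ) • (((dp : ℤ) • tp) ≫ nq) = (dp : ℤ) • (tp ≫ nq) := by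
    rw [Nat.cast_one, one_smul, Preadditive.zsmul_comp]
  have e4 : ((dq * degq : ℕ) : ℤ) • nf = ((dq : ℤ) • tq) ≫ np := by
    rw [← hnf, Preadditive.zsmul_comp, ← Category.assoc, hdeg, Preadditive.zsmul_comp, Category.id_comp, smul_smul, Nat.cast_mul]
  haveI := hZ N
  rw [e3, e4]
  exact levelAdjoint_pushPull Θ₂ Θ₁ Θ' hq hp hdiv₂ hdiv' N P R

end AbelianVariety

end Literature.AlgebraicGeometry.Motives

end
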